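import Mathlib
import Literature.Analysis.FluidPDE.Tao2016AveragedNS.ShiftSetCascadeFlows
import Literature.Analysis.FluidPDE.Tao2016AveragedNS.ShiftSetCascadeFlux
import Summits.NavierStokesRegularity.NavierStokesRegularity.Theorems.TaoLadderRungTwoFlatQuadPolarOn
import Summits.NavierStokesRegularity.NavierStokesRegularity.Theorems.TaoLadderRungTwoFlatLinearisedUniqueness
import Summits.NavierStokesRegularity.NavierStokesRegularity.Theorems.TaoLadderRungTwoFlatLinearisedGronwall
import Summits.NavierStokesRegularity.NavierStokesRegularity.Theorems.TaoLadderRungTwoFlatFlowContinuity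
import Summits.NavierStokesRegularity.NavierStokesRegularity.Theorems.TaoLadderRungTwoFlatHomogeneousL2Field
import HarnessLib

/-!
# GAUGE (weighted sup-norm) Duhamel–Gronwall bounds for the forced linearised lattice equation from a PLAIN sup-norm
  a priori bound — finite speed of propagation on nearest-neighbour shift sets
  (helper for item stmt-NavierStokesRegularity-22987 `FlatGapCertificatesV2`, crux K_A♭ of route TaoLadderRungTwoFlat;
  cell harvest/h2-tao-ladder, p1 g20 — the weighted norms of the transfer plan, LADDER §47.3, and of (S2)
  `MirrorPulse.LinearisedHopContraction`, whose gauges grow geometrically ahead of the front)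

The abstract gauge Gronwall `LatticeGronwall.weighted_abs_le_exp` needs an a priori bound of the WEIGHTED family on
`[0, T]`. For `u̇ = Lin_Φ(u) + f` at scale ratio `1` on a NEAREST-NEIGHBOUR shift set this is unnecessary: `Lin_Φ(u)_{i,n}`
only reads `u` on the window `{n−1, n, n+1}` (`QuadPolar.linTermOn_windowFam`), so the Picard majorants run site by site
with the constants `B/w_{i,n}`, `F/w_{i,n}` once the gauge is REGULAR ACROSS THE WINDOW (`w_{i,n} ≤ Λ·w_{j,k}`,
`|k − n| ≤ 1`), and the only a priori input is the plain sup bound `|u| ≤ M_u` on `[0, T]`: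

* `IsWindowRegular w Λ`; `gauge_abs_le_forced_majorant` — site-wise Picard majorants
  `|u_{i,n}(s)| ≤ (B/w_{i,n} + (F/w_{i,n}) s)·Σ_{l<j}(L's)^l/l! + M_u (L's)^j/j!`, `L' = 2‖α‖₁ M_Φ Λ`;
* `gauge_abs_le_forced_exp` — **`w_{i,n}|u_{i,n}(s)| ≤ (B + F s)·exp(2‖α‖₁ M_Φ Λ s)` on `[0, T]`** from `w|u(0)| ≤ B`,
  `w|f| ≤ F` and `|u| ≤ M_u` only (finite speed of propagation: data `B/w_k` far ahead is reached no faster than the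
  factorial light cone, which a geometric gauge absorbs); `gauge_abs_le_exp` (unforced);
* `gauge_abs_sub_le` — gauge form of the continuity of exact global solutions in the data (midpoint linearisation).

HONEST FRAMING: elementary real analysis for MODEL lattices (Tao 2016 §4 vocabulary, shift-set parametrised); nothing
certified; nothing here is a statement about the Navier–Stokes equations.
-/

noncomputable section

-- the sub-problem namespace repeats the summit name by design (D-0017)
set_option linter.dupNamespace false

namespace Summit.NavierStokesRegularity.NavierStokesRegularity.Theorems

open Set Filter Literature.Analysis.FluidPDE Literature.Analysis.FluidPDE.TaoCascade
open scoped Topology Nat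

namespace QuadPolar

variable {m : ℕ}

/-! ### Gauges regular across the nearest-neighbour window -/

/-- A gauge `w > 0` on `Fin m × ℤ` is **window-regular with constant `Λ ≥ 1`** when `w_{i,n} ≤ Λ·w_{j,k}` for all
species `i, j` and all `k ∈ {n−1, n, n+1}` (e.g. `w_k = g^{k⁺} b^{−k⁻}` with `Λ = max g b`). [folklore] -/
def IsWindowRegular (w : Fin m → ℤ → ℝ) (Λ : ℝ) : Prop :=
  (∀ i n, 0 < w i n) ∧ 1 ≤ Λ ∧ ∀ (i j : Fin m) (n k : ℤ), n - 1 ≤ k ∧ k ≤ n + 1 → w i n ≤ Λ * w j k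

/-! ### Picard majorants in the gauge -/

/-- **Site-wise Picard majorants with forcing, in a window-regular gauge.** For `u̇ = Lin_Φ(u) + f` on a
nearest-neighbour shift set with `w|f| ≤ F` on `[0, T]` (`F ≥ 0`), `w|u(0)| ≤ B`, the PLAIN bound `|u| ≤ M_u` on
`[0, T]`, and a continuous background `|Φ| ≤ M_Φ`: for every `j`,
`|u_{i,n}(s)| ≤ (B/w_{i,n} + (F/w_{i,n}) s)·Σ_{l<j}(L's)^l/l! + M_u (L's)^j/j!` on `[0, T]`, `L' = 2‖α‖₁ M_Φ Λ`.
[cite: Tao2016AveragedNS, §4 (4.8); folklore (Picard iteration)] -/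
theorem gauge_abs_le_forced_majorant {𝕊 : Finset (ℤ × ℤ × ℤ)} (h𝕊 : IsNearestNeighbourSet 𝕊)
    (α : Fin m → Fin m → Fin m → ℤ × ℤ × ℤ → ℝ) {w : Fin m → ℤ → ℝ} {Λ : ℝ} (hw : IsWindowRegular w Λ)
    {Φ u f : Fin m → ℤ → ℝ → ℝ} {MΦ Mu B F T : ℝ} (hΦc : ∀ j k, Continuous (Φ j k))
    (hΦ : ∀ j k t, |Φ j k t| ≤ MΦ) (hfc : ∀ j k, Continuous (f j k))
    (hf : ∀ j k, ∀ t ∈ Icc 0 T, w j k * |f j k t| ≤ F) (hF : 0 ≤ F)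
    (hder : ∀ i n t, HasDerivAt (u i n) (linTermOn 𝕊 0 α Φ u i n t + f i n t) t)
    (hbdd : ∀ i n, ∀ t ∈ Icc 0 T, |u i n t| ≤ Mu) (hB : ∀ i n, w i n * |u i n 0| ≤ B) :
    ∀ (j : ℕ) (i : Fin m) (n : ℤ), ∀ s ∈ Icc 0 T,
      |u i n s| ≤ (B / w i n + F / w i n * s) *
          ∑ l ∈ Finset.range j, (2 * tableAbsSum 𝕊 α * MΦ * Λ * s) ^ l / l ! +
        Mu * (2 * tableAbsSum 𝕊 α * MΦ * Λ * s) ^ j / j ! := by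
  have hpos := hw.1
  have hΛ := hw.2.1
  set L := 2 * tableAbsSum 𝕊 α * MΦ * Λ with hL
  have huc : ∀ j k, Continuous (u j k) := fun j k =>
    continuous_iff_continuousAt.2 fun t => (hder j k t).continuousAt
  have hLc : ∀ i n, Continuous fun t => linTermOn 𝕊 0 α Φ u i n t + f i n t :=
    fun i n => (continuous_linTermOn 𝕊 0 α hΦc huc i n).add (hfc i n)
  intro j
  induction j with
  | zero =>
    intro i n s hs
    simpa using hbdd i n s hs
  | succ j ih =>
    intro i n s hs
    have hs0 : 0 ≤ s := hs.1
    have hwin : 0 < w i n := hpos i n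
    have hMΦ : 0 ≤ MΦ := (abs_nonneg _).trans (hΦ i n 0)
    have hA0 := tableAbsSum_nonneg 𝕊 α
    have hL0 : 0 ≤ L := by rw [hL]; positivity
    have hB0 : 0 ≤ B := le_trans (mul_nonneg hwin.le (abs_nonneg _)) (hB i n)
    have hMu : 0 ≤ Mu := (abs_nonneg _).trans (hbdd i n 0 ⟨le_rfl, hs0.trans hs.2⟩)
    -- per-site constants
    set B' : ℝ := B / w i n with hB'
    set F' : ℝ := F / w i n with hF'
    have hB'0 : 0 ≤ B' := by rw [hB']; positivity
    have hF'0 : 0 ≤ F' := by rw [hF']; positivity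
    have hftc : ∫ σ in (0 : ℝ)..s, (linTermOn 𝕊 0 α Φ u i n σ + f i n σ) = u i n s - u i n 0 :=
      intervalIntegral.integral_eq_sub_of_hasDerivAt (fun σ _ => hder i n σ) ((hLc i n).intervalIntegrable _ _)
    -- pointwise bound of the integrand on [0, s]
    have hpt : ∀ σ ∈ Icc 0 s, |linTermOn 𝕊 0 α Φ u i n σ + f i n σ| ≤
        F' + L * ((B' + F' * s) * ∑ l ∈ Finset.range j, (L * σ) ^ l / l ! + Mu * (L * σ) ^ j / j !) := by
      intro σ hσ
      have hσT : σ ∈ Icc 0 T := ⟨hσ.1, hσ.2.trans hs.2⟩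
      have hsum0 : 0 ≤ ∑ l ∈ Finset.range j, (L * σ) ^ l / (l ! : ℝ) :=
        Finset.sum_nonneg fun l _ => by have := hσ.1; positivity
      have hpow0 : 0 ≤ Mu * (L * σ) ^ j / j ! := by have := hσ.1; positivity
      -- window sup of the level-j majorant
      set Wσ : ℝ := Λ * (B' + F' * s) * ∑ l ∈ Finset.range j, (L * σ) ^ l / l ! + Mu * (L * σ) ^ j / j ! with hWσ
      have hΛ0 : 0 ≤ Λ := le_trans zero_le_one hΛ
      have hWσ0 : 0 ≤ Wσ := by
        have h1 : 0 ≤ B' + F' * s := by positivity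
        have h2 : 0 ≤ Λ * (B' + F' * s) * ∑ l ∈ Finset.range j, (L * σ) ^ l / (l ! : ℝ) :=
          mul_nonneg (mul_nonneg hΛ0 h1) hsum0
        rw [hWσ]; linarith
      have hb : ∀ j' k, |windowFam n u j' k σ| ≤ Wσ := by
        intro j' k
        unfold windowFam
        split_ifs with hk
        · have hih := ih j' k σ hσT
          have hwjk : 0 < w j' k := hpos j' k
          -- (B/w_{j'k} + F/w_{j'k} σ) ≤ Λ (B' + F' s)
          have hcoef : B / w j' k + F / w j' k * σ ≤ Λ * (B' + F' * s) := by
            have e1 : B / w j' k + F / w j' k * σ = (B + F * σ) / w j' k := by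
              rw [add_div, mul_div_right_comm]
            have e2 : Λ * (B' + F' * s) = Λ * (B + F * s) / w i n := by
              rw [hB', hF']; field_simp
            rw [e1, e2, div_le_div_iff₀ hwjk hwin]
            have hBs : B + F * σ ≤ B + F * s := by nlinarith [hσ.2]
            have hBs0 : 0 ≤ B + F * s := by positivity
            calc (B + F * σ) * w i n ≤ (B + F * s) * (Λ * w j' k) :=
                  mul_le_mul hBs (hw.2.2 i j' n k hk) hwin.le hBs0
              _ = Λ * (B + F * s) * w j' k := by ring
          calc |u j' k σ| ≤ (B / w j' k + F / w j' k * σ) * ∑ l ∈ Finset.range j, (L * σ) ^ l / l ! +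
                Mu * (L * σ) ^ j / j ! := hih
            _ ≤ Λ * (B' + F' * s) * ∑ l ∈ Finset.range j, (L * σ) ^ l / l ! + Mu * (L * σ) ^ j / j ! := by
                have := mul_le_mul_of_nonneg_right hcoef hsum0
                linarith
        · rw [abs_zero]; exact hWσ0
      have hlin : |linTermOn 𝕊 0 α Φ u i n σ| ≤ 2 * tableAbsSum 𝕊 α * MΦ * Wσ := by
        rw [← linTermOn_windowFam h𝕊 0 α Φ u i n σ]
        exact abs_linTermOn_zero_le 𝕊 α (fun j' k => hΦ j' k σ) hb i n
      have hlin' : 2 * tableAbsSum 𝕊 α * MΦ * Wσ ≤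
          L * ((B' + F' * s) * ∑ l ∈ Finset.range j, (L * σ) ^ l / l ! + Mu * (L * σ) ^ j / j !) := by
        rw [hWσ, hL]
        have h1 : 2 * tableAbsSum 𝕊 α * MΦ * (Mu * (2 * tableAbsSum 𝕊 α * MΦ * Λ * σ) ^ j / ↑j !) ≤
            2 * tableAbsSum 𝕊 α * MΦ * Λ * (Mu * (2 * tableAbsSum 𝕊 α * MΦ * Λ * σ) ^ j / ↑j !) := by
          have h0 : 0 ≤ 2 * tableAbsSum 𝕊 α * MΦ * (Mu * (2 * tableAbsSum 𝕊 α * MΦ * Λ * σ) ^ j / ↑j !) := by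
            rw [← hL]; positivity
          nlinarith
        rw [← hL] at h1 ⊢
        nlinarith [h1]
      have hf' : |f i n σ| ≤ F' := by
        rw [hF', le_div_iff₀ hwin, mul_comm]; exact hf i n σ hσT
      calc |linTermOn 𝕊 0 α Φ u i n σ + f i n σ|
          ≤ |linTermOn 𝕊 0 α Φ u i n σ| + |f i n σ| := abs_add_le _ _
        _ ≤ L * ((B' + F' * s) * ∑ l ∈ Finset.range j, (L * σ) ^ l / l ! + Mu * (L * σ) ^ j / j !) + F' :=
            add_le_add (hlin.trans hlin') hf'
        _ = F' + L * ((B' + F' * s) * ∑ l ∈ Finset.range j, (L * σ) ^ l / l ! + Mu * (L * σ) ^ j / j !) := by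
            ring
    have hmaj2 : Continuous fun σ : ℝ =>
        L * ((B' + F' * s) * ∑ l ∈ Finset.range j, (L * σ) ^ l / l ! + Mu * (L * σ) ^ j / j !) := by
      refine continuous_const.mul (Continuous.add ?_ ?_)
      · exact continuous_const.mul (continuous_finsetSum _ fun l _ =>
          ((continuous_const.mul continuous_id).pow l).div_const _)
      · exact (continuous_const.mul ((continuous_const.mul continuous_id).pow j)).div_const _
    have hmaj_cont : Continuous fun σ : ℝ =>
        F' + L * ((B' + F' * s) * ∑ l ∈ Finset.range j, (L * σ) ^ l / l ! + Mu * (L * σ) ^ j / j !) :=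
      continuous_const.add hmaj2
    have hI : ∫ σ in (0 : ℝ)..s,
        (F' + L * ((B' + F' * s) * ∑ l ∈ Finset.range j, (L * σ) ^ l / l ! + Mu * (L * σ) ^ j / j !)) =
        F' * s + ((B' + F' * s) * ∑ l ∈ Finset.range j, (L * s) ^ (l + 1) / (l + 1)! +
          Mu * (L * s) ^ (j + 1) / (j + 1)!) := by
      rw [intervalIntegral.integral_add intervalIntegrable_const (hmaj2.intervalIntegrable _ _),
        intervalIntegral.integral_const, integral_majorant, smul_eq_mul, sub_zero, mul_comm s F']
    have hu_eq : u i n s = u i n 0 + ∫ σ in (0 : ℝ)..s, (linTermOn 𝕊 0 α Φ u i n σ + f i n σ) := by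
      rw [hftc]; ring
    have hB'' : |u i n 0| ≤ B' := by
      rw [hB', le_div_iff₀ hwin, mul_comm]; exact hB i n
    calc |u i n s| = |u i n 0 + ∫ σ in (0 : ℝ)..s, (linTermOn 𝕊 0 α Φ u i n σ + f i n σ)| := by rw [← hu_eq]
      _ ≤ |u i n 0| + |∫ σ in (0 : ℝ)..s, (linTermOn 𝕊 0 α Φ u i n σ + f i n σ)| := abs_add_le _ _
      _ ≤ B' + ∫ σ in (0 : ℝ)..s, |linTermOn 𝕊 0 α Φ u i n σ + f i n σ| :=
          add_le_add hB'' (intervalIntegral.abs_integral_le_integral_abs hs0)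
      _ ≤ B' + ∫ σ in (0 : ℝ)..s,
            (F' + L * ((B' + F' * s) * ∑ l ∈ Finset.range j, (L * σ) ^ l / l ! + Mu * (L * σ) ^ j / j !)) := by
          gcongr
          exact intervalIntegral.integral_mono_on hs0 (((hLc i n).abs).intervalIntegrable _ _)
            (hmaj_cont.intervalIntegrable _ _) hpt
      _ = B' + (F' * s + ((B' + F' * s) * ∑ l ∈ Finset.range j, (L * s) ^ (l + 1) / (l + 1)! +
            Mu * (L * s) ^ (j + 1) / (j + 1)!)) := by rw [hI]
      _ = (B' + F' * s) * ∑ l ∈ Finset.range (j + 1), (L * s) ^ l / l ! + Mu * (L * s) ^ (j + 1) / (j + 1)! := by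
          rw [Finset.sum_range_succ' (fun l => (L * s) ^ l / (l ! : ℝ))]
          simp only [pow_zero, Nat.factorial_zero, Nat.cast_one, div_one]
          ring

/-- **GAUGE DUHAMEL–GRONWALL BOUND from a plain sup bound**: under the hypotheses of `gauge_abs_le_forced_majorant`,
`w_{i,n}|u_{i,n}(s)| ≤ (B + F s)·exp(2‖α‖₁ M_Φ Λ s)` on `[0, T]`.
[cite: Tao2016AveragedNS, §4 (4.8); folklore (Gronwall, finite speed of propagation)] -/
theorem gauge_abs_le_forced_exp {𝕊 : Finset (ℤ × ℤ × ℤ)} (h𝕊 : IsNearestNeighbourSet 𝕊)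
    (α : Fin m → Fin m → Fin m → ℤ × ℤ × ℤ → ℝ) {w : Fin m → ℤ → ℝ} {Λ : ℝ} (hw : IsWindowRegular w Λ)
    {Φ u f : Fin m → ℤ → ℝ → ℝ} {MΦ Mu B F T : ℝ} (hΦc : ∀ j k, Continuous (Φ j k))
    (hΦ : ∀ j k t, |Φ j k t| ≤ MΦ) (hfc : ∀ j k, Continuous (f j k))
    (hf : ∀ j k, ∀ t ∈ Icc 0 T, w j k * |f j k t| ≤ F) (hF : 0 ≤ F)
    (hder : ∀ i n t, HasDerivAt (u i n) (linTermOn 𝕊 0 α Φ u i n t + f i n t) t)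
    (hbdd : ∀ i n, ∀ t ∈ Icc 0 T, |u i n t| ≤ Mu) (hB : ∀ i n, w i n * |u i n 0| ≤ B) (i : Fin m) (n : ℤ)
    {s : ℝ} (hs : s ∈ Icc 0 T) : w i n * |u i n s| ≤ (B + F * s) * Real.exp (2 * tableAbsSum 𝕊 α * MΦ * Λ * s) := by
  have hwin : 0 < w i n := hw.1 i n
  set x := 2 * tableAbsSum 𝕊 α * MΦ * Λ * s with hx
  have hMΦ : 0 ≤ MΦ := (abs_nonneg _).trans (hΦ i n 0)
  have hΛ : 0 ≤ Λ := le_trans zero_le_one hw.2.1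
  have hx0 : 0 ≤ x := by rw [hx]; have := tableAbsSum_nonneg 𝕊 α; have := hs.1; positivity
  have hB0 : 0 ≤ B := le_trans (mul_nonneg hwin.le (abs_nonneg _)) (hB i n)
  have hB'0 : 0 ≤ B / w i n + F / w i n * s := by have := hs.1; positivity
  have hmaj : ∀ j : ℕ, |u i n s| ≤ (B / w i n + F / w i n * s) * Real.exp x + Mu * x ^ j / j ! := by
    intro j
    have h := gauge_abs_le_forced_majorant h𝕊 α hw hΦc hΦ hfc hf hF hder hbdd hB j i n s hs
    have hsum : (B / w i n + F / w i n * s) * ∑ l ∈ Finset.range j, x ^ l / l ! ≤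
        (B / w i n + F / w i n * s) * Real.exp x :=
      mul_le_mul_of_nonneg_left (Real.sum_le_exp_of_nonneg hx0 j) hB'0
    rw [← hx] at h
    linarith
  have hlim : Tendsto (fun j : ℕ => (B / w i n + F / w i n * s) * Real.exp x + Mu * x ^ j / j !) atTop
      (𝓝 ((B / w i n + F / w i n * s) * Real.exp x)) := by
    have h := (Real.summable_pow_div_factorial x).tendsto_atTop_zero
    have h2 := (h.const_mul Mu).const_add ((B / w i n + F / w i n * s) * Real.exp x)
    rw [mul_zero, add_zero] at h2
    refine h2.congr fun j => ?_
    ring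
  have hle : |u i n s| ≤ (B / w i n + F / w i n * s) * Real.exp x := ge_of_tendsto' hlim hmaj
  have e : w i n * ((B / w i n + F / w i n * s) * Real.exp x) = (B + F * s) * Real.exp x := by
    field_simp
  calc w i n * |u i n s| ≤ w i n * ((B / w i n + F / w i n * s) * Real.exp x) :=
        mul_le_mul_of_nonneg_left hle hwin.le
    _ = (B + F * s) * Real.exp x := e

/-- **GAUGE GRONWALL BOUND (unforced)**: `u̇ = Lin_Φ(u)`, `w|u(0)| ≤ B`, `|u| ≤ M_u` on `[0, T]` ⟹
`w_{i,n}|u_{i,n}(s)| ≤ B·exp(2‖α‖₁ M_Φ Λ s)` on `[0, T]`. [cite: Tao2016AveragedNS, §4 (4.8); folklore (Gronwall)] -/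
theorem gauge_abs_le_exp {𝕊 : Finset (ℤ × ℤ × ℤ)} (h𝕊 : IsNearestNeighbourSet 𝕊)
    (α : Fin m → Fin m → Fin m → ℤ × ℤ × ℤ → ℝ) {w : Fin m → ℤ → ℝ} {Λ : ℝ} (hw : IsWindowRegular w Λ)
    {Φ u : Fin m → ℤ → ℝ → ℝ} {MΦ Mu B T : ℝ} (hΦc : ∀ j k, Continuous (Φ j k))
    (hΦ : ∀ j k t, |Φ j k t| ≤ MΦ)
    (hder : ∀ i n t, HasDerivAt (u i n) (linTermOn 𝕊 0 α Φ u i n t) t)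
    (hbdd : ∀ i n, ∀ t ∈ Icc 0 T, |u i n t| ≤ Mu) (hB : ∀ i n, w i n * |u i n 0| ≤ B) (i : Fin m) (n : ℤ)
    {s : ℝ} (hs : s ∈ Icc 0 T) : w i n * |u i n s| ≤ B * Real.exp (2 * tableAbsSum 𝕊 α * MΦ * Λ * s) := by
  have h := gauge_abs_le_forced_exp h𝕊 α hw (f := fun _ _ _ => 0) (F := 0) hΦc hΦ (fun _ _ => continuous_const)
    (fun j k t _ => by simp) le_rfl (fun i n t => by simpa using hder i n t) hbdd hB i n hs
  simpa using h

/-! ### Continuity in the data, gauge form -/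

/-- **GAUGE CONTINUITY IN THE DATA** (scale ratio `1`, nearest-neighbour shift set, any table): two exact global
solutions bounded by `M` everywhere with `w|X(0) − W(0)| ≤ B` in a window-regular gauge satisfy
`w_{i,n}|X_{i,n}(s) − W_{i,n}(s)| ≤ B·exp(2‖α‖₁ M Λ s)` for `0 ≤ s` — the deviation stays as localised as the gauge,
from plain boundedness alone. [cite: Tao2016AveragedNS, §4 (4.8); folklore (Gronwall)] -/
theorem gauge_abs_sub_le {𝕊 : Finset (ℤ × ℤ × ℤ)} (h𝕊 : IsNearestNeighbourSet 𝕊)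
    (α : Fin m → Fin m → Fin m → ℤ × ℤ × ℤ → ℝ) {w : Fin m → ℤ → ℝ} {Λ : ℝ} (hw : IsWindowRegular w Λ)
    {X W : Fin m → ℤ → ℝ → ℝ} {M B : ℝ}
    (hX : ∀ i n t, HasDerivAt (X i n) (quadTermOn 𝕊 0 α X i n t) t)
    (hW : ∀ i n t, HasDerivAt (W i n) (quadTermOn 𝕊 0 α W i n t) t)
    (hXb : ∀ i n t, |X i n t| ≤ M) (hWb : ∀ i n t, |W i n t| ≤ M)
    (hB : ∀ i n, w i n * |X i n 0 - W i n 0| ≤ B) (i : Fin m) (n : ℤ) {s : ℝ} (hs : 0 ≤ s) :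
    w i n * |X i n s - W i n s| ≤ B * Real.exp (2 * tableAbsSum 𝕊 α * M * Λ * s) := by
  set Ψ : Fin m → ℤ → ℝ → ℝ := (1 / 2 : ℝ) • (X + W) with hΨ
  set η : Fin m → ℤ → ℝ → ℝ := X - W with hη
  have hXc : ∀ j k, Continuous (X j k) := fun j k => continuous_iff_continuousAt.2 fun t => (hX j k t).continuousAt
  have hWc : ∀ j k, Continuous (W j k) := fun j k => continuous_iff_continuousAt.2 fun t => (hW j k t).continuousAt
  have hΨc : ∀ j k, Continuous (Ψ j k) := fun j k => by
    show Continuous fun t => (1 / 2 : ℝ) * (X j k t + W j k t)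
    exact continuous_const.mul ((hXc j k).add (hWc j k))
  have hΨb : ∀ j k t, |Ψ j k t| ≤ M := fun j k t => by
    show |(1 / 2 : ℝ) * (X j k t + W j k t)| ≤ M
    rw [abs_mul, abs_of_pos (by norm_num : (0 : ℝ) < 1 / 2)]
    linarith [abs_add_le (X j k t) (W j k t), hXb j k t, hWb j k t]
  have hder : ∀ j k t, HasDerivAt (η j k) (linTermOn 𝕊 0 α Ψ η j k t) t := fun j k t => by
    rw [hΨ, hη, ← quadTermOn_sub_eq_linTermOn_mid]
    exact (hX j k t).sub (hW j k t)
  have hηb : ∀ j k, ∀ t ∈ Icc 0 s, |η j k t| ≤ 2 * M := fun j k t _ => by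
    show |X j k t - W j k t| ≤ 2 * M
    linarith [abs_sub (X j k t) (W j k t), hXb j k t, hWb j k t]
  exact gauge_abs_le_exp h𝕊 α hw hΨc hΨb hder hηb hB i n ⟨hs, le_rfl⟩

end QuadPolar

end Summit.NavierStokesRegularity.NavierStokesRegularity.Theorems

end
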